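import Summits.NavierStokesRegularity.FluidComputer.GeometricFace
import Literature.Analysis.FluidPDE.HolderHalfDirectionCriterion
import HarnessLib

/-!
# Fluid computer — the level dictionary, HÖLDER-COHERENCE FACE (L48): the vorticity direction is not even
# ½-Hölder coherent over the intense set (Beirão da Veiga–Berselli)

HONEST FRAMING (cell `pub-fluidc`, verbatim): *low prior, high value-of-information experiment on Tao's
machine paradigm; NOT a claim that NS blows up.* Theorem side of the cell; nothing here is evidence of blow-up.
L32 (Constantin–Fefferman) says that in every terminal window the vorticity direction `ξ = ω/|ω|` is not
LIPSCHITZ-coherent (`|sin∠(ξ(x),ξ(y))| ≤ |x − y|/ρ`) over the intense set `{|ω| > Ω}`. Beirão da Veiga–Berselli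
(2002, Thm. 1.2, Assumption A with `α = ½`; Lemarié-Rieusset 2016, Thm. 11.7) halve the exponent: ½-HÖLDER coherence
`|sin∠(ξ(x,t), ξ(y,t))| ≤ M|x − y|^{1/2}` over `{|ω| > Ω}` already prevents blow-up — PROVED in the tree as
`holderHalf_direction_criterion` (classical solutions in the Beale–Kato–Majda class on closed sub-slabs; the class
hypothesis is discharged on the dictionary's class by gen 15's `GeometricFace.hasBoundedSobolevNormsOn_translate`).
For every maximal smooth solution `(u, p)` of the unforced Navier–Stokes system on `ℝ³ × [0, T)` (`ν > 0`) which is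
Leray–Hopf from `u 0`:

* `vorticityDirection_not_holderHalf_coherent` (**L48 — NO ½-HÖLDER COHERENCE OF THE VORTEX LINES**): for every
  threshold `Ω > 0`, every constant `M` and every `t₀ ∈ [0, T)` it is NOT the case that
  `√(1 − ⟪ξ(x,t), ξ(y,t)⟫²) ≤ M √|x − y|` for all `t ∈ [t₀, T)` and all `x, y` with `|ω(x,t)|, |ω(y,t)| > Ω`;
* `exists_incoherent_pair` (unfolded): for all `Ω > 0`, `M`, `t₀ < T` there are `t ∈ [t₀, T)` and intense points
  `x, y` (`|ω| > Ω`) whose directions make an angle with `|sin| > M√|x − y|`.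

Reading for the machine paradigm (words): in every terminal window the vortex lines over the intense set must kink
so sharply that the sine of their relative angle beats EVERY multiple of the square root of the separation — the
Hölder modulus of the direction field over `{|ω| > Ω}` blows up at exponent `½`, not merely at exponent `1` (L32).
A design of gently bending tubes is excluded quantitatively. Qualitative in time (no rate). Necessity only.
0 sorry; no new definitions, no named facts.

## References

* H. Beirão da Veiga, L. C. Berselli, Differential Integral Equations 15 (2002) 345–356, Thm. 1.2.
  [BeiraodaveigaBerselli2002]
* P. Constantin, C. Fefferman, Indiana Univ. Math. J. 42 (1993) 775–789. [ConstantinFeffermanIndiana1993]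
* P. G. Lemarié-Rieusset, CRC 2016, Thm. 11.7. [LemarieRieusset2016]
-/

noncomputable section

open MeasureTheory Set Function Filter Topology Metric
open scoped ENNReal NNReal
open Literature.Analysis.FluidPDE Literature.Analysis.FunctionSpaces
open Summit.NavierStokesRegularity.FluidComputer.GeometricFace

namespace Summit.NavierStokesRegularity.FluidComputer.DirectionHolderFace

/-- **L48 — THE VORTICITY DIRECTION IS NOT ½-HÖLDER COHERENT OVER THE INTENSE SET IN ANY TERMINAL WINDOW.** For
`ν > 0`, `T > 0`, every maximal smooth solution `(u, p)` of the unforced Navier–Stokes system on `ℝ³ × [0, T)` which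
is Leray–Hopf from `u 0`, every `Ω > 0`, every `M` and every `t₀ ∈ [0, T)`: the bound
`√(1 − ⟪ξ(x,t), ξ(y,t)⟫²) ≤ M√‖x − y‖` for all `t ∈ [t₀, T)` and all `x, y` with `‖curl u(t,x)‖, ‖curl u(t,y)‖ > Ω`
FAILS. Otherwise Beirão da Veiga–Berselli's criterion (`holderHalf_direction_criterion`, PROVED in the tree) applied
to the translate at `s = (t₀ + T)/2` — classical on `[0, T − s)`, in the BKM class on every closed sub-slab by
`hasBoundedSobolevNormsOn_translate` — would continue it past `T − s`, contradicting maximality.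
[cite: BeiraodaveigaBerselli2002, Thm. 1.2 (Assumption A, α = 1/2, Remark 1.1)]
[cite: LemarieRieusset2016, Thm. 11.7 (PDF p. 369)] -/
theorem vorticityDirection_not_holderHalf_coherent {ν T : ℝ} (hν : 0 < ν) (hT : 0 < T)
    {u : ℝ → EuclideanSpace ℝ (Fin 3) → EuclideanSpace ℝ (Fin 3)} {p : ℝ → EuclideanSpace ℝ (Fin 3) → ℝ}
    (hmax : IsMaximalSmoothSolution ν 0 u p T) (hLH : IsLerayHopfOn T ν 0 (u 0) u)
    {Ω : ℝ} (hΩ : 0 < Ω) (M : ℝ) {t₀ : ℝ} (ht₀ : t₀ ∈ Ico 0 T) :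
    ¬ (∀ t ∈ Ico t₀ T, ∀ x y : EuclideanSpace ℝ (Fin 3), Ω < ‖curl (u t) x‖ → Ω < ‖curl (u t) y‖ →
        Real.sqrt (1 - inner ℝ (vorticityDirection (curl (u t)) x) (vorticityDirection (curl (u t)) y) ^ 2) ≤
          M * Real.sqrt ‖x - y‖) := by
  intro hdir
  set s : ℝ := (t₀ + T) / 2 with hsdef
  have hs : s ∈ Ioo 0 T := ⟨by rw [hsdef]; linarith [ht₀.1, ht₀.2], by rw [hsdef]; linarith [ht₀.2]⟩
  have ht₀s : t₀ < s := by rw [hsdef]; linarith [ht₀.2]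
  have hTs : 0 < T - s := sub_pos.2 hs.2
  have hmaxs := hmax.translate_zero hs.1 hs.2
  have hreg : ∀ T'' < T - s, HasBoundedSobolevNormsOn (Icc 0 T'') (fun t => u (t + s)) :=
    fun T'' hT'' => hasBoundedSobolevNormsOn_translate hν hT hmax hLH hs hT''
  have hdir' : ∀ t ∈ Ico 0 (T - s), ∀ x y : EuclideanSpace ℝ (Fin 3),
      Ω < ‖curl ((fun t => u (t + s)) t) x‖ → Ω < ‖curl ((fun t => u (t + s)) t) y‖ →
        Real.sqrt (1 - inner ℝ (vorticityDirection (curl ((fun t => u (t + s)) t)) x)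
          (vorticityDirection (curl ((fun t => u (t + s)) t)) y) ^ 2) ≤ M * Real.sqrt ‖x - y‖ :=
    fun t ht x y hx hy => hdir (t + s) ⟨by linarith [ht.1], by linarith [ht.2]⟩ x y hx hy
  have hext : HasSobolevExtensionPast ν (fun t => u (t + s)) (T - s) :=
    holderHalf_direction_criterion hν hTs hΩ hmaxs.1 hreg hdir'
  exact hmaxs.2 hext.hasSmoothExtensionPast

/-- **L48, unfolded — an incoherent intense pair in every terminal window at every Hölder constant**: for all
`Ω > 0`, `M`, `t₀ ∈ [0, T)` there are `t ∈ [t₀, T)` and points `x, y` with `‖curl u(t,x)‖, ‖curl u(t,y)‖ > Ω` and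
`M√‖x − y‖ < √(1 − ⟪ξ(x,t), ξ(y,t)⟫²)` (`|sin∠|` beats `M√(separation)`).
[cite: BeiraodaveigaBerselli2002, Thm. 1.2] -/
theorem exists_incoherent_pair {ν T : ℝ} (hν : 0 < ν) (hT : 0 < T)
    {u : ℝ → EuclideanSpace ℝ (Fin 3) → EuclideanSpace ℝ (Fin 3)} {p : ℝ → EuclideanSpace ℝ (Fin 3) → ℝ}
    (hmax : IsMaximalSmoothSolution ν 0 u p T) (hLH : IsLerayHopfOn T ν 0 (u 0) u)
    {Ω : ℝ} (hΩ : 0 < Ω) (M : ℝ) {t₀ : ℝ} (ht₀ : t₀ ∈ Ico 0 T) :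
    ∃ t ∈ Ico t₀ T, ∃ x y : EuclideanSpace ℝ (Fin 3), Ω < ‖curl (u t) x‖ ∧ Ω < ‖curl (u t) y‖ ∧
      M * Real.sqrt ‖x - y‖ <
        Real.sqrt (1 - inner ℝ (vorticityDirection (curl (u t)) x) (vorticityDirection (curl (u t)) y) ^ 2) := by
  have h := vorticityDirection_not_holderHalf_coherent hν hT hmax hLH hΩ M ht₀
  push Not at h
  exact h

end Summit.NavierStokesRegularity.FluidComputer.DirectionHolderFace

end
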